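import Literature.NumberTheory.EllipticCurves.ZpExtensionDescentProofs
import HarnessLib

/-!
# Descent of `γ`-invariant classes along a `ℤ_p`-extension when the coefficients have NO non-zero
# `Gal(K̄/K_∞)`-fixed vector (inflation–restriction surjectivity, any finite discrete `M`; proofs only)

Topic `Literature/NumberTheory/EllipticCurves` (sequel to `ZpExtensionDescentProofs`, whose
`ZpDescent.exists_resSubgroup_eq_of_conjH1_eq` treats `p • M = 0`; cell `pub/bsd-print-x9`, blueprint
HOME/p2/S1-DISCRETE-CONTROL §1(c), file F3 — the SURJECTIVITY half, generic form).  THEOREMS ONLY; no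
definition, no named fact, no instance, no `sorry`.

**Theorem** (`ZpDescent.exists_resSubgroup_eq_of_conjH1_eq_of_forall_fixed_eq_zero`).  Let `κ : Γ_K ↠ ℤ_p` be a
`ℤ_p`-extension of the number field `K`, `N = ker κ = Gal(K̄/K_∞)`, `γ` with `κ γ = 1`, and `M` a FINITE discrete
`Γ_K`-module with open stabilisers and **`M^N = 0`** (no non-zero vector fixed by `N`; e.g. `E[p^k]` when
`E(K_∞)[p] = 0`, or `E[p^k] ⊗ A_{m,k}` with the Eisenstein-twisted action).  Then every class
`x ∈ H¹(K_∞, M)` with `conj_γ x = x` is the restriction of a class of `H¹(K, M)`.  No torsion hypothesis on `M`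
(the sibling needs `p • M = 0` to kill the obstruction at a deeper level; here the obstruction — which is `N`-fixed,
`hobN` of the sibling's proof — vanishes OUTRIGHT by `M^N = 0`, so the sibling's extension `ĉ(γᵏ n u) = s_k + γᵏ c(n)`
(`ZpDescent.ext`) works already at the first level `U₀`).  This is the right end of
`0 → H¹(Γ, M^N) → H¹(K, M) → H¹(K_∞, M)^Γ → H²(Γ, M^N)` with `M^N = 0` (Serre I.§2.6 (b); Greenberg LNM 1716 §3
Lemma 3.2), proved `H²`-free.  Use (S1-DISCRETE): with F2/F3-inj (`IwasawaEisensteinTwistedCocycle*Proofs`) it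
makes `ι_{m,k} : H¹(K, A_q[p^k]) → H¹(K_∞, E[p^k])[ψ_m]` bijective once the twisted module is packaged as a
discrete `Γ_K`-module (next file of the lineage).

References: [SerreGaloisCohomology1997] I.§2.6 (b); [GreenbergLNM1716] §3 Lemma 3.2 (p. 86);
[NeukirchSchmidtWingberg2008] Prop. 1.6.7.  BSD is not proved by any of this.
-/

noncomputable section

open Literature.NumberTheory.EllipticCurves Literature.NumberTheory.GaloisRepresentations

namespace Literature.NumberTheory.EllipticCurves

namespace ZpDescent

open scoped Pointwise

universe u

variable {K : Type u} [Field K] [NumberField K] {p : ℕ} [Fact p.Prime] {κ : ZpExtension K p}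
  {γ : Field.absoluteGaloisGroup K}
  {M : Type u} [AddCommGroup M] [DistribMulAction (Field.absoluteGaloisGroup K) M]
  [TopologicalSpace M] [DiscreteTopology M]

/-- **Descent of `γ`-invariant classes when `M^{Gal(K̄/K_∞)} = 0`.**  For `κ` a `ℤ_p`-extension of the number
field `K`, `γ` with `κ γ = 1`, and `M` a finite discrete `Γ_K`-module with open stabilisers and no non-zero
`ker κ`-fixed vector, every `x ∈ H¹(K_∞, M)` with `conj_γ x = x` is `res y` for some `y ∈ H¹(K, M)` — the
surjectivity of `H¹(K, M) → H¹(K_∞, M)^Γ` (Greenberg, LNM 1716, §3 Lemma 3.2: «`Γ_n ≅ ℤ_p` is a free pro-`p`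
group. Hence `H²(Γ_n, B) = 0`. Thus `h_n` is surjective»), proved by the explicit extension of the sibling file
with the obstruction killed by `M^N = 0`. [cite: GreenbergLNM1716, §3 Lemma 3.2] [cite: SerreGaloisCohomology1997, I.§2.6 (b)] -/
theorem exists_resSubgroup_eq_of_conjH1_eq_of_forall_fixed_eq_zero [Finite M] (hγ : κ.IsTopGenerator γ)
    (hstab : ∀ v : M, IsOpen ((MulAction.stabilizer (Field.absoluteGaloisGroup K) v : Subgroup _) :
      Set (Field.absoluteGaloisGroup K)))
    (hfix : ∀ v : M, (∀ h ∈ κ.kerSubgroup, h • v = v) → v = 0) (x : subgroupH1 κ.kerSubgroup M)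
    (hx : conjH1 κ.kerSubgroup M γ x = x) :
    ∃ y : discreteH1 (Field.absoluteGaloisGroup K) M, ResKernel.resSubgroup κ.kerSubgroup M y = x := by
  classical
  obtain ⟨φ, rfl⟩ := oneCocycleClass_surjective _ x
  -- the cocycle as a function on `Γ_K`
  let c : Field.absoluteGaloisGroup K → M := fun g ↦ if hg : g ∈ κ.kerSubgroup then φ.1 ⟨g, hg⟩ else 0
  have hcN : ∀ (g) (hg : g ∈ κ.kerSubgroup), c g = φ.1 ⟨g, hg⟩ := fun g hg ↦ dif_pos hg
  have hc : IsCocycleOn κ.kerSubgroup c := by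
    intro h hh h' hh'
    rw [hcN _ (κ.kerSubgroup.mul_mem hh hh'), hcN _ hh, hcN _ hh']
    exact φ.2 ⟨h, hh⟩ ⟨h', hh'⟩
  -- (⋆) from `γ`-invariance
  have hconjφ : conjH1 κ.kerSubgroup M γ (oneCocycleClass _ φ) = oneCocycleClass _
      (contOneCocycles.pullback (subgroupConj κ.kerSubgroup γ)
        (resHomOfEquivariant (subgroupConj κ.kerSubgroup γ) (DistribSMul.toAddMonoidHom M γ) (fun x m ↦ by
          simp only [DistribSMul.toAddMonoidHom_apply, Subgroup.smul_def, subgroupConj_apply_coe,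
            smul_smul, mul_assoc, mul_inv_cancel_left])) φ) :=
    map_oneCocycleClass _ _ _ φ
  rw [hconjφ, ← sub_eq_zero, ← oneCocycleClass_sub, oneCocycleClass_eq_zero_iff] at hx
  obtain ⟨m, hm⟩ := hx
  have hstar : ∀ h ∈ κ.kerSubgroup, conjTwist γ c h = c h + cob m h := by
    intro h hh
    have := hm ⟨h, hh⟩
    rw [Submodule.coe_sub, ContinuousMap.sub_apply, contOneCocycles.pullback_apply] at this
    change γ • φ.1 (subgroupConj κ.kerSubgroup γ ⟨h, hh⟩) - φ.1 ⟨h, hh⟩ = h • m - m at this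
    rw [conjTwist_apply, cob_apply, hcN _ hh,
      hcN _ (by simpa using Subgroup.Normal.conj_mem inferInstance h hh γ⁻¹)]
    rw [sub_eq_iff_eq_add'] at this
    exact this
  -- `U₀`: open normal, fixing `M` pointwise and killing `φ` near `1`
  have hzero : IsOpen {h : κ.kerSubgroup | φ.1 h = 0} :=
    (isOpen_discrete ({0} : Set M)).preimage φ.1.continuous
  obtain ⟨O, hO, hOeq⟩ := isOpen_induced_iff.mp hzero
  have h1O : (1 : Field.absoluteGaloisGroup K) ∈ O := by
    have : (1 : κ.kerSubgroup) ∈ Subtype.val ⁻¹' O := by rw [hOeq]; exact contOneCocycles.apply_one φ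
    exact this
  obtain ⟨U₀, hU₀⟩ := ProfiniteGrp.exist_openNormalSubgroup_sub_open_nhds_of_one
    ((isOpen_fixator M hstab).inter hO) ⟨fun v ↦ one_smul _ v, h1O⟩
  have hUM₀ : ∀ u ∈ U₀.toSubgroup, ∀ v : M, u • v = v := fun u hu v ↦ (hU₀ hu).1 v
  have hUc₀ : ∀ x ∈ κ.kerSubgroup, x ∈ U₀.toSubgroup → c x = 0 := fun x hx hxU ↦ by
    rw [hcN _ hx]
    have : (⟨x, hx⟩ : κ.kerSubgroup) ∈ Subtype.val ⁻¹' O := (hU₀ hxU).2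
    rw [hOeq] at this
    exact this
  -- decomposition of `γ^{t₀}` at level `U₀`
  set t₀ := levelOrder κ (γ := γ) U₀.toSubgroup with ht₀def
  obtain ⟨n₀, hn₀, u₀, hu₀, h₀⟩ := exists_eq_mul_of_mem_sup (κ := κ) U₀.toSubgroup
    ((levelOrder_dvd_iff (γ := γ) U₀.toSubgroup _).mp dvd_rfl)
  -- the obstruction `ob = c n₀ - s_{t₀}` is `N`-fixed, hence ZERO by `M^N = 0`
  set ob := c n₀ - sPow γ m t₀ with hob
  have hobN : ∀ h ∈ κ.kerSubgroup, h • ob = ob := by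
    intro h hh
    have k1 := conjTwist_pow (N := κ.kerSubgroup) γ m hstar t₀ h hh
    have k2 : conjTwist (γ ^ t₀) c h = c h + cob (c n₀) h := by
      rw [h₀, conjTwist_mul]
      rw [conjTwist_congr κ.kerSubgroup n₀ (hc.conjTwist_of_trivial U₀.toSubgroup hUM₀ hUc₀ hu₀) h hh]
      exact hc.conjTwist_of_mem hn₀ h hh
    rw [k2, add_right_inj, cob_apply, cob_apply] at k1
    rw [hob, smul_sub]
    exact sub_eq_sub_iff_sub_eq_sub.mp k1
  have hob0 : ob = 0 := hfix ob hobN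
  have hkey : c n₀ = sPow γ m t₀ := by
    rw [← sub_eq_zero]; exact hob0
  -- the extension data at level `U₀`
  let D : ExtData κ.kerSubgroup U₀.toSubgroup γ m c :=
    { t := t₀
      t_pos := levelOrder_pos U₀.toSubgroup U₀.isOpen
      nt := n₀
      ut := u₀
      nt_mem := hn₀
      ut_mem := hu₀
      pow_t := h₀
      key := hkey
      dvd_of_mem := fun d n u hn hu e ↦ (levelOrder_dvd_iff U₀.toSubgroup d).mpr
        (e ▸ Subgroup.mul_mem _ (Subgroup.mem_sup_left hn) (Subgroup.mem_sup_right hu))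
      cover := exists_decomp hγ U₀.toSubgroup U₀.isOpen }
  -- the extended cocycle is continuous (right-`U₀`-invariant, `U₀` open)
  have hcont : Continuous (ext D) := by
    refine IsLocallyConstant.continuous ((IsLocallyConstant.iff_eventually_eq _).mpr fun g ↦ ?_)
    have hopen : IsOpen ((fun g' ↦ g⁻¹ * g') ⁻¹' (U₀.toSubgroup : Set (Field.absoluteGaloisGroup K))) :=
      U₀.isOpen.preimage (continuous_const_mul g⁻¹)
    refine Filter.eventually_of_mem (hopen.mem_nhds (by simp)) fun g' hg' ↦ ?_
    have e : g' = g * (g⁻¹ * g') := by group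
    rw [e, ext_mul_of_mem hc hUM₀ hUc₀ D g hg']
  let Φ : contOneCocycles (discreteTopRep (Field.absoluteGaloisGroup K) M) :=
    ⟨⟨ext D, hcont⟩, fun g h ↦ ext_mul hc hUM₀ hUc₀ hstar D g h⟩
  refine ⟨oneCocycleClass _ Φ, ?_⟩
  rw [ResKernel.resSubgroup_oneCocycleClass]
  congr 1
  apply Subtype.ext
  ext h
  rw [contOneCocycles.pullback_apply]
  change ext D (h : Field.absoluteGaloisGroup K) = φ.1 h
  rw [ext_of_mem hc hUM₀ hUc₀ D h.2, hcN _ h.2]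

end ZpDescent

end Literature.NumberTheory.EllipticCurves
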